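/-
Copyright (c) 2026 the pub-hodgecm-mathlib formalisation cell (harness21).  Prover seat hodgecm-mathlib-K2E3-p11 (g3), Track B «K2-LIT» ∕ h413,
line `K2_E3_EllipticInputs`, unit U12 «Characters», socket #11 `sig_K2E3CharLocIntNearSemisimple`, road (11-PS) «by class: principal series».
FILE 2 of the road: THE WEYL INTEGRATION FORMULA ON THE HYPERBOLIC SET IN DENSITY FORM FOR MEASURABLE TEST FUNCTIONS.  2026-09-04.
-/
import Summits.HodgeConjecture.HodgeConjecture.Theorems.F0P3cStCharTSWeylHypWIFDensity   -- ★ (LH6-p03) the density WIF, unconditional; brings ★ Socket `tubeJacobianSocket_vanDijkWeight_sq`, ★ WIFJac ∕ WIFJacLocal ∕ WIF ∕ JacobianLocal, ★ TorusDefs ∕ ChartIso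
import HarnessLib

/-!
# K2_E3 road (h413 = stmt-HodgeConjecture-24833), unit U12 «Characters», socket #11 — road (11-PS) «BY CLASS: PRINCIPAL SERIES», FILE 2:
# the Weyl integration formula of `U(Φ₃)(L⁺_v)` (`v` non-split) on the regular hyperbolic set `Ω`, DENSITY FORM `dσ = (Re Δ)² dμ`, for MEASURABLE `φ` supported in `Ω`
# with `φ·α ∈ L¹(Ω)` (Rogawski 1990 §12.5 p. 182; Harish-Chandra 1970 Lemmas 22, 42)

Cell `pub/hodgecm-mathlib` (D-0151), Track B, `--supports stmt-HodgeConjecture-24833 --as helper` (count-neutral); THEOREMS ONLY — no `def`, no instance, no notation, no named fact,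
no `sorry`; ★-only imports.  Seat K2E3-p11 (g3), default self-deal (11-PS).

THE POINT.  ★ `F0P3cStCharTSWeylHypWIFDensity.integral_mul_eq_integral_classOrbitalIntegral_density_vanDijkWeight_sq` (the (TOR) road's UNCONDITIONAL density form of the Weyl
integration formula on `Ω = hyperbolicSet L v`) is stated for test functions `φ` with `IsLocSmooth φ` and `tsupport φ ⊆ Ω`.  Its ★ proof (★ p849989 ∕ (J6-pre) ∕ (J0) ★
`integral_hypSet_eq_of_tubeJacobian_local`) reads `φ` ONLY through measurability, the integrability of `φ·α` on `Ω` and the vanishing of `φ` off `Ω` — exactly the hypotheses of ★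
`exists_radialMeasure_integral_mul_classFun` (radial form).  This file records that generality, needed by FILE 3 of the road: there the test function is `𝟙_Ω · φ` for a
`φ ∈ C_c^∞(G)` NOT supported in `Ω` (the character `Θ_χ` of `i_G(χ)` vanishes off `Ω`, and the orbital integrals of `𝟙_Ω·φ` and `φ` agree at the regular torus classes).
* **`integral_mul_eq_integral_classOrbitalIntegral_density_of_measurable`** — for every Haar `μM` on `M = E_vˣ × E¹_v`, every measurable `D : T → ℝ≥0` with `(D t : ℝ) = (Re Δ t)²`,
  all measurable `φ, α : G → ℂ` with `α` conjugation invariant on `Ω`, `φ·α` `ν`-integrable on `Ω` and `φ = 0` off `Ω`: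
  `∫ φ·α dν = ∫_M classOrbitalIntegral mQv φ ⟦ι m⟧ · ((2·((ι_*μM)(compactCore T)).toReal)⁻¹ · D(ι m)) · α(ι m) dμM`.
* (ED. 2) **`integrable_classOrbitalIntegral_density_mul_of_measurable`** — under the same hypotheses the density-side integrand is `μM`-INTEGRABLE (the Fubini half of ★ (J0)).
The proof is ★ (J6-pre)'s, verbatim, with the socket `hJacLoc` discharged by ★ (J6) FILE 6 `tubeJacobianSocket_vanDijkWeight_sq` (as in ★ …WIFDensity) and the two uses of
smoothness replaced by the hypotheses `hint`, `hφ0`.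

HONEST LABEL: HC_CM is proved only modulo the 7 printed citations (2 remaining named inputs: hLiu418 = stmt-HodgeConjecture-24832, h413 = stmt-HodgeConjecture-24833)
until rung 0 closes; count-neutral helper (row #11 stays OPEN).

## References
* [Rogawski1990] J. D. Rogawski, *Automorphic Representations of Unitary Groups in Three Variables*, Ann. of Math. Stud. 123 (1990), §12.5 p. 182 (the Weyl integration formula),
  §12.7 L. 12.7.2 (proof) p. 193, §4.3 (4.3.1) p. 43.
* [HarishChandra1970] Harish-Chandra (notes by G. van Dijk), *Harmonic Analysis on Reductive p-adic Groups*, LNM 162 (1970), Part V §4 Lemma 22; Lemma 42.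
* [DeitmarEchterhoff2014] A. Deitmar, S. Echterhoff, *Principles of Harmonic Analysis*, 2nd ed. (2014), Thm. 1.5.3 (quotient integral formula).
-/

set_option autoImplicit false
-- the mandated namespace has the single-problem summit's repeated segment (`HodgeConjecture.HodgeConjecture`)
set_option linter.dupNamespace false

noncomputable section

open MeasureTheory Measure Set Filter Topology Function NumberField IsDedekindDomain Matrix
open Literature.MeasureTheory.Group
open Literature.NumberTheory.Automorphic Literature.NumberTheory.Automorphic.UnitaryGroup Literature.NumberTheory.Rogawski1990
open Summit.HodgeConjecture.HodgeConjecture.Cruxes.H413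
open Summit.HodgeConjecture.HodgeConjecture.Cruxes.H413.F0P3cStCharTSWeylHypMeasure
open Summit.HodgeConjecture.HodgeConjecture.Cruxes.H413.F0P3cStCharTSWeylHypCM
open Summit.HodgeConjecture.HodgeConjecture.Cruxes.H413.F0P3cStCharTSWeylHypTorsor
open Summit.HodgeConjecture.HodgeConjecture.Cruxes.H413.F0P3cStCharTSWeylHypJacobian
open Summit.HodgeConjecture.HodgeConjecture.Cruxes.H413.F0P3cStCharTSWeylHypJacobianLocal
open Summit.HodgeConjecture.HodgeConjecture.Cruxes.H413.F0P3cStCharTSWeylHypJacobianSocket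
open Summit.HodgeConjecture.HodgeConjecture.Cruxes.H413.F0P3cStCharTSWeylHypWIF
open Summit.HodgeConjecture.HodgeConjecture.Cruxes.H413.F0P3cStCharTSWeylHypWIFJac
open Summit.HodgeConjecture.HodgeConjecture.Cruxes.H413.F0P3cStCharTSTorusDefs
open Summit.HodgeConjecture.HodgeConjecture.Cruxes.H413.F0P3cStCharTSTorusChartIso
open scoped ENNReal NNReal MatrixGroups Pointwise

namespace Summit.HodgeConjecture.HodgeConjecture.Cruxes.H413.K2E3WeylHypDensityMeasurable

section CM

variable (L : Type) [Field L] [NumberField L] [IsCMField L] (v : HeightOneSpectrum (𝓞 ↥(maximalRealSubfield L)))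

set_option maxHeartbeats 1600000 in
set_option synthInstance.maxHeartbeats 400000 in
-- instance-term unification at the CM carrier (`quotientMeasure` ∕ canonical family), as in ★ p849989 ∕ ★ (J6-pre)
/-- **THE WEYL INTEGRATION FORMULA ON THE HYPERBOLIC SET, DENSITY FORM, MEASURABLE TEST FUNCTIONS** (`v` non-split; `ν` Haar on `G = U(Φ₃)(L⁺_v)`, `mQv` canonical for the regular
classes, `μM` Haar on `M = E_vˣ × E¹_v`, `ι = torusChart L v`, `w` the element with matrix `Φ₃`, `D = (Re Δ)²` on `T` as an `ℝ≥0`-valued measurable function).  For all measurable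
`φ, α : G → ℂ` with `α` conjugation invariant on `Ω = hyperbolicSet L v`, `φ·α` `ν`-integrable on `Ω` and `φ = 0` off `Ω`:
**`∫ φ·α dν = ∫_M classOrbitalIntegral mQv φ ⟦ι m⟧ · ((2·((ι_*μM)(compactCore T)).toReal)⁻¹ · D(ι m)) · α(ι m) dμM`.**
Proof = ★ (J6-pre) `integral_mul_eq_integral_classOrbitalIntegral_density_of_tubeJacobian_local` verbatim with `hJacLoc := ★ tubeJacobianSocket_vanDijkWeight_sq` and the smoothness of
`φ` replaced by (`hφm`, `hint`, `hφ0`). [cite: Rogawski1990, §12.5 p. 182; §12.7 L. 12.7.2 (proof) p. 193] [cite: HarishChandra1970, Lemma 22; Lemma 42]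
[cite: DeitmarEchterhoff2014, Thm. 1.5.3] -/
theorem integral_mul_eq_integral_classOrbitalIntegral_density_of_measurable
    (hns : ∀ w : PlacesOver L v, IsCMField.complexConj L • w.1 = w.1)
    [MeasurableSpace ↥(unitaryGroupOfForm (conjLocal L (IsCMField.complexConj L) v) (cmLocalForm L 3 v))] [BorelSpace ↥(unitaryGroupOfForm (conjLocal L (IsCMField.complexConj L) v) (cmLocalForm L 3 v))] [LocallyCompactSpace ↥(unitaryGroupOfForm (conjLocal L (IsCMField.complexConj L) v) (cmLocalForm L 3 v))] [SecondCountableTopology ↥(unitaryGroupOfForm (conjLocal L (IsCMField.complexConj L) v) (cmLocalForm L 3 v))] [T2Space ↥(unitaryGroupOfForm (conjLocal L (IsCMField.complexConj L) v) (cmLocalForm L 3 v))]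
    [∀ γ : ↥(unitaryGroupOfForm (conjLocal L (IsCMField.complexConj L) v) (cmLocalForm L 3 v)), MeasurableSpace (↥(unitaryGroupOfForm (conjLocal L (IsCMField.complexConj L) v) (cmLocalForm L 3 v)) ⧸ Subgroup.centralizer ({γ} : Set ↥(unitaryGroupOfForm (conjLocal L (IsCMField.complexConj L) v) (cmLocalForm L 3 v))))] [∀ γ : ↥(unitaryGroupOfForm (conjLocal L (IsCMField.complexConj L) v) (cmLocalForm L 3 v)), BorelSpace (↥(unitaryGroupOfForm (conjLocal L (IsCMField.complexConj L) v) (cmLocalForm L 3 v)) ⧸ Subgroup.centralizer ({γ} : Set ↥(unitaryGroupOfForm (conjLocal L (IsCMField.complexConj L) v) (cmLocalForm L 3 v))))]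
    [MeasurableSpace ((LocalRing L v)ˣ × ↥(normOneUnits (conjLocal L (IsCMField.complexConj L) v)))] [BorelSpace ((LocalRing L v)ˣ × ↥(normOneUnits (conjLocal L (IsCMField.complexConj L) v)))]
    (ν : Measure ↥(unitaryGroupOfForm (conjLocal L (IsCMField.complexConj L) v) (cmLocalForm L 3 v))) [ν.IsHaarMeasure] [ν.IsMulRightInvariant]
    {mQv : OrbitalMeasureFamily ↥(unitaryGroupOfForm (conjLocal L (IsCMField.complexConj L) v) (cmLocalForm L 3 v))} (hcanQ : mQv.IsCanonical (fun γ => IsRegularElt (γ.val : GL (Fin 3) (LocalRing L v))) ν)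
    (μM : Measure ((LocalRing L v)ˣ × ↥(normOneUnits (conjLocal L (IsCMField.complexConj L) v)))) [μM.IsHaarMeasure]
    (w : ↥(unitaryGroupOfForm (conjLocal L (IsCMField.complexConj L) v) (cmLocalForm L 3 v))) (hw : Units.val (w : GL (Fin 3) (LocalRing L v)) = cmLocalForm L 3 v)
    (D : ↥(cmBorelTriple L 3 v).M → ℝ≥0) (hD : Measurable D)
    (hDsq : ∀ t : ↥(cmBorelTriple L 3 v).M, (D t : ℝ) = ((vanDijkWeight L v t).re) ^ 2) :
    ∀ φ α : ↥(unitaryGroupOfForm (conjLocal L (IsCMField.complexConj L) v) (cmLocalForm L 3 v)) → ℂ, Measurable φ → Measurable α →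
      (∀ x : ↥(unitaryGroupOfForm (conjLocal L (IsCMField.complexConj L) v) (cmLocalForm L 3 v)), x ∈ (hyperbolicSet L v : Set ↥(unitaryGroupOfForm (conjLocal L (IsCMField.complexConj L) v) (cmLocalForm L 3 v))) → ∀ h : ↥(unitaryGroupOfForm (conjLocal L (IsCMField.complexConj L) v) (cmLocalForm L 3 v)), α (h * x * h⁻¹) = α x) →
      IntegrableOn (fun x => φ x * α x) (hyperbolicSet L v : Set ↥(unitaryGroupOfForm (conjLocal L (IsCMField.complexConj L) v) (cmLocalForm L 3 v))) ν →
      (∀ x : ↥(unitaryGroupOfForm (conjLocal L (IsCMField.complexConj L) v) (cmLocalForm L 3 v)), x ∉ (hyperbolicSet L v : Set ↥(unitaryGroupOfForm (conjLocal L (IsCMField.complexConj L) v) (cmLocalForm L 3 v))) → φ x = 0) →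
        ∫ x, φ x * α x ∂ν =
          ∫ m, classOrbitalIntegral mQv φ (ConjClasses.mk (((torusChart L v m : ↥(cmBorelTriple L 3 v).M) : ↥(unitaryGroupOfForm (conjLocal L (IsCMField.complexConj L) v) (cmLocalForm L 3 v))))) *
            ((((2 * ((μM.map (torusChart L v)) (compactCore ↥(cmBorelTriple L 3 v).M)).toReal)⁻¹ * (D (torusChart L v m) : ℝ) : ℝ) : ℂ) *
              α ((torusChart L v m : ↥(cmBorelTriple L 3 v).M) : ↥(unitaryGroupOfForm (conjLocal L (IsCMField.complexConj L) v) (cmLocalForm L 3 v)))) ∂μM := by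
  intro φ α hφm hαm hαinv hint hφ0
  classical
  letI : MeasurableSpace (↥(unitaryGroupOfForm (conjLocal L (IsCMField.complexConj L) v) (cmLocalForm L 3 v)) ⧸ (cmBorelTriple L 3 v).M) := borel _
  haveI : BorelSpace (↥(unitaryGroupOfForm (conjLocal L (IsCMField.complexConj L) v) (cmLocalForm L 3 v)) ⧸ (cmBorelTriple L 3 v).M) := ⟨rfl⟩
  have hT := isClosed_cmBorelTriple_M L v
  haveI := hT
  have hTc : ∀ a ∈ (cmBorelTriple L 3 v).M, ∀ b ∈ (cmBorelTriple L 3 v).M, a * b = b * a := fun a ha b hb => mul_comm_of_mem_torusU_cmLocal L v ha hb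
  haveI : LocallyCompactSpace ↥(cmBorelTriple L 3 v).M := hT.isClosedEmbedding_subtypeVal.locallyCompactSpace
  haveI : SecondCountableTopology ↥(cmBorelTriple L 3 v).M := TopologicalSpace.Subtype.secondCountableTopology _
  -- §a the Haar measure `tm = ι_* μM` on `T`, the constant `c₀`, THE normalised measure `tT`
  set tm : Measure ↥(cmBorelTriple L 3 v).M := μM.map (torusChart L v) with htm
  haveI : tm.IsHaarMeasure := isHaarMeasure_map_torusChart L v μM
  haveI := F0P3cStCharTSTorusRay.secondCountableTopology_torus L v
  haveI := F0P3cStCharTSTorusRay.locallyCompactSpace_torus L v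
  haveI : μM.Regular := inferInstance
  haveI : μM.IsInvInvariant := inferInstance
  haveI : tm.IsInvInvariant := by
    rw [htm, ← coe_torusChartEquiv]
    exact isInvInvariant_map_mulEquiv (torusChartEquiv L v).toMulEquiv (torusChartEquiv L v).continuous.measurable μM
  obtain ⟨hcoreC, hcoreO⟩ := isCompact_isOpen_compactCore_cmTorus L v
  set c₀ : ℝ≥0∞ := tm (compactCore ↥(cmBorelTriple L 3 v).M) with hc₀
  have hc0 : c₀ ≠ 0 := (hcoreO.measure_pos tm ⟨1, one_mem_compactCore⟩).ne'
  have hctop : c₀ ≠ ∞ := hcoreC.measure_lt_top.ne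
  set tT : Measure ↥(cmBorelTriple L 3 v).M := c₀⁻¹ • tm with htT
  haveI : tT.IsHaarMeasure := Measure.IsHaarMeasure.smul tm (ENNReal.inv_ne_zero.2 hctop) (ENNReal.inv_ne_top.2 hc0)
  haveI : tT.IsInvInvariant := ⟨by rw [Measure.inv_def, htT, Measure.map_smul, ← Measure.inv_def, Measure.inv_eq_self]⟩
  have htT1 : tT (compactCore ↥(cmBorelTriple L 3 v).M) = 1 := by
    rw [htT, Measure.smul_apply, smul_eq_mul, ENNReal.inv_mul_cancel hc0 hctop]
  -- §b the conjugation family; the LOCAL socket at `tT` in ★ p851645's tube shape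
  obtain ⟨Φ, hΦ⟩ := exists_conjFamily (cmBorelTriple L 3 v).M hTc
  have hJ := tubeJacobianSocket_vanDijkWeight_sq L v hns ν w hw D hDsq tT inferInstance inferInstance htT1
  have htube : ∀ (A₀ : Set (↥(unitaryGroupOfForm (conjLocal L (IsCMField.complexConj L) v) (cmLocalForm L 3 v)) ⧸ (cmBorelTriple L 3 v).M)) (V : Set ↥(cmBorelTriple L 3 v).M), Φ '' (A₀ ×ˢ V) =
      {y : ↥(unitaryGroupOfForm (conjLocal L (IsCMField.complexConj L) v) (cmLocalForm L 3 v)) | ∃ (x : ↥(unitaryGroupOfForm (conjLocal L (IsCMField.complexConj L) v) (cmLocalForm L 3 v))) (t : ↥(cmBorelTriple L 3 v).M), (QuotientGroup.mk x : ↥(unitaryGroupOfForm (conjLocal L (IsCMField.complexConj L) v) (cmLocalForm L 3 v)) ⧸ (cmBorelTriple L 3 v).M) ∈ A₀ ∧ t ∈ V ∧ y = x * t * x⁻¹} := by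
    intro A₀ V
    ext y
    constructor
    · rintro ⟨⟨q, t⟩, ⟨hq, ht⟩, rfl⟩
      obtain ⟨x, rfl⟩ := QuotientGroup.mk_surjective q
      exact ⟨x, t, hq, ht, hΦ x t⟩
    · rintro ⟨x, t, hx, ht, rfl⟩
      exact ⟨(QuotientGroup.mk x, t), ⟨hx, ht⟩, hΦ x t⟩
  have hJacLoc' : ∀ t₀ : ↥(cmBorelTriple L 3 v).M, IsRegularElt (((t₀ : ↥(unitaryGroupOfForm (conjLocal L (IsCMField.complexConj L) v) (cmLocalForm L 3 v)))) : GL (Fin 3) (LocalRing L v)) →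
      ∃ U : Set ↥(cmBorelTriple L 3 v).M, IsOpen U ∧ t₀ ∈ U ∧
        ∃ A₀ : Set (↥(unitaryGroupOfForm (conjLocal L (IsCMField.complexConj L) v) (cmLocalForm L 3 v)) ⧸ (cmBorelTriple L 3 v).M), MeasurableSet A₀ ∧ (quotientMeasure (cmBorelTriple L 3 v).M tT (isClosed_cmBorelTriple_M L v) ν) A₀ ≠ 0 ∧ (quotientMeasure (cmBorelTriple L 3 v).M tT (isClosed_cmBorelTriple_M L v) ν) A₀ ≠ ∞ ∧
          ∀ V : Set ↥(cmBorelTriple L 3 v).M, MeasurableSet V → V ⊆ U → (∀ t ∈ V, IsRegularElt (((t : ↥(unitaryGroupOfForm (conjLocal L (IsCMField.complexConj L) v) (cmLocalForm L 3 v)))) : GL (Fin 3) (LocalRing L v))) →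
            (∀ t ∈ V, ∀ t' ∈ V, ((t' : ↥(cmBorelTriple L 3 v).M) : ↥(unitaryGroupOfForm (conjLocal L (IsCMField.complexConj L) v) (cmLocalForm L 3 v))) ≠ w * t * w⁻¹) →
              ν (Φ '' (A₀ ×ˢ V)) = (quotientMeasure (cmBorelTriple L 3 v).M tT (isClosed_cmBorelTriple_M L v) ν) A₀ * ∫⁻ t in V, (D t : ℝ≥0∞) ∂tT := by
    intro t₀ ht₀
    obtain ⟨U, hUo, hU0, A₀, hA₀m, hA₀0, hA₀top, hJ'⟩ := hJ t₀ ht₀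
    exact ⟨U, hUo, hU0, A₀, hA₀m, hA₀0, hA₀top, fun V hVm hVU hVreg hVfree => by rw [htube]; exact hJ' V hVm hVU hVreg hVfree⟩
  -- §c ★ p851645 (Bochner form, LOCAL socket) at `g := φ · α`
  have hΩ := hyperbolicSet_eq_hypSet L v
  rw [hΩ] at hint hφ0
  obtain ⟨-, heq⟩ := integral_hypSet_eq_of_tubeJacobian_local L v hns ν tT Φ hΦ w hw D hD hJacLoc' (fun x => φ x * α x) hint
  -- §d the inner fibre integral at a regular `t` is `α(t) · O^{can}_t(φ)`
  have hinner : ∀ t : ↥(cmBorelTriple L 3 v).M, IsRegularElt (((t : ↥(unitaryGroupOfForm (conjLocal L (IsCMField.complexConj L) v) (cmLocalForm L 3 v)))) : GL (Fin 3) (LocalRing L v)) →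
      ∫ q, φ (Φ (q, t)) * α (Φ (q, t)) ∂(quotientMeasure (cmBorelTriple L 3 v).M tT (isClosed_cmBorelTriple_M L v) ν) =
        classOrbitalIntegral mQv φ (ConjClasses.mk (t : ↥(unitaryGroupOfForm (conjLocal L (IsCMField.complexConj L) v) (cmLocalForm L 3 v)))) * α t := by
    intro t ht
    have htΩ : (t : ↥(unitaryGroupOfForm (conjLocal L (IsCMField.complexConj L) v) (cmLocalForm L 3 v))) ∈ {x | ∃ g t : ↥(unitaryGroupOfForm (conjLocal L (IsCMField.complexConj L) v) (cmLocalForm L 3 v)), t ∈ (cmBorelTriple L 3 v).M ∧ IsRegularElt (t : GL (Fin 3) (LocalRing L v)) ∧ g * t * g⁻¹ = x} := mem_hypSet_of_mem_torusU (conjLocal L (IsCMField.complexConj L) v) (cmLocalForm L 3 v) t.2 ht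
    rw [← hΩ] at htΩ
    have hpt : ∀ q, φ (Φ (q, t)) * α (Φ (q, t)) = φ (Φ (q, t)) * α t := by
      intro q
      induction q using QuotientGroup.induction_on with
      | H x => rw [hΦ, hαinv _ htΩ x]
    rw [integral_congr_ae (Eventually.of_forall hpt), integral_mul_const,
      classOrbitalIntegral_mk_eq_integral_conjFamily L v ν hcanQ tT htT1 Φ hΦ t ht φ hφm]
  -- §e assemble: `∫ φα = ½ ∫_{T^reg} D • (α · O) dtT = ½ ∫_T … dtT = ½ c₀⁻¹ ∫_M … ∘ ι dμM`
  have hSm := (isOpen_setOf_isRegularElt_torusU (conjLocal L (IsCMField.complexConj L) v) (cmLocalForm L 3 v)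
    (isUnit_of_ne_zero_of_nonsplit L v hns) (R := LocalRing L v)).measurableSet
  have h1 : ∫ x, φ x * α x ∂ν = ∫ x in {x | ∃ g t : ↥(unitaryGroupOfForm (conjLocal L (IsCMField.complexConj L) v) (cmLocalForm L 3 v)), t ∈ (cmBorelTriple L 3 v).M ∧ IsRegularElt (t : GL (Fin 3) (LocalRing L v)) ∧ g * t * g⁻¹ = x}, φ x * α x ∂ν :=
    (setIntegral_eq_integral_of_forall_compl_eq_zero fun x hx => by rw [hφ0 x hx, zero_mul]).symm
  have h2 : ∫ t in {t : ↥(cmBorelTriple L 3 v).M | IsRegularElt (((t : ↥(unitaryGroupOfForm (conjLocal L (IsCMField.complexConj L) v) (cmLocalForm L 3 v)))) : GL (Fin 3) (LocalRing L v))},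
      (D t : ℝ) • ∫ q, φ (Φ (q, t)) * α (Φ (q, t)) ∂(quotientMeasure (cmBorelTriple L 3 v).M tT (isClosed_cmBorelTriple_M L v) ν) ∂tT =
      ∫ t, (D t : ℝ) • (classOrbitalIntegral mQv φ (ConjClasses.mk (t : ↥(unitaryGroupOfForm (conjLocal L (IsCMField.complexConj L) v) (cmLocalForm L 3 v)))) * α t) ∂tT := by
    have hae : ∀ᵐ t : ↥(cmBorelTriple L 3 v).M ∂tT, t ∈ {t : ↥(cmBorelTriple L 3 v).M | IsRegularElt (((t : ↥(unitaryGroupOfForm (conjLocal L (IsCMField.complexConj L) v) (cmLocalForm L 3 v)))) : GL (Fin 3) (LocalRing L v))} :=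
      ae_isRegularElt_cmTorus L v tT
    rw [setIntegral_congr_fun hSm fun t ht => by rw [hinner t ht], Measure.restrict_eq_self_of_ae_mem hae]
  have h3 : (2 : ℝ) • ∫ x, φ x * α x ∂ν =
      ∫ t, (D t : ℝ) • (classOrbitalIntegral mQv φ (ConjClasses.mk (t : ↥(unitaryGroupOfForm (conjLocal L (IsCMField.complexConj L) v) (cmLocalForm L 3 v)))) * α t) ∂tT := by
    rw [h1, ← heq, h2]
  have h4 : ∫ t, (D t : ℝ) • (classOrbitalIntegral mQv φ (ConjClasses.mk (t : ↥(unitaryGroupOfForm (conjLocal L (IsCMField.complexConj L) v) (cmLocalForm L 3 v)))) * α t) ∂tT =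
      (c₀⁻¹).toReal • ∫ m, (D (torusChart L v m) : ℝ) •
        (classOrbitalIntegral mQv φ (ConjClasses.mk (((torusChart L v m : ↥(cmBorelTriple L 3 v).M) : ↥(unitaryGroupOfForm (conjLocal L (IsCMField.complexConj L) v) (cmLocalForm L 3 v))))) * α ((torusChart L v m : ↥(cmBorelTriple L 3 v).M) : ↥(unitaryGroupOfForm (conjLocal L (IsCMField.complexConj L) v) (cmLocalForm L 3 v)))) ∂μM := by
    rw [htT, integral_smul_measure, htm, integral_comp_torusChart]
  calc ∫ x, φ x * α x ∂ν = (2 : ℝ)⁻¹ • ((2 : ℝ) • ∫ x, φ x * α x ∂ν) := by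
        rw [smul_smul, inv_mul_cancel₀ (two_ne_zero' ℝ), one_smul]
    _ = (2 : ℝ)⁻¹ • ((c₀⁻¹).toReal • ∫ m, (D (torusChart L v m) : ℝ) •
          (classOrbitalIntegral mQv φ (ConjClasses.mk (((torusChart L v m : ↥(cmBorelTriple L 3 v).M) : ↥(unitaryGroupOfForm (conjLocal L (IsCMField.complexConj L) v) (cmLocalForm L 3 v))))) *
            α ((torusChart L v m : ↥(cmBorelTriple L 3 v).M) : ↥(unitaryGroupOfForm (conjLocal L (IsCMField.complexConj L) v) (cmLocalForm L 3 v)))) ∂μM) := by rw [h3, h4]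
    _ = ∫ m, (2 : ℝ)⁻¹ • ((c₀⁻¹).toReal • ((D (torusChart L v m) : ℝ) •
          (classOrbitalIntegral mQv φ (ConjClasses.mk (((torusChart L v m : ↥(cmBorelTriple L 3 v).M) : ↥(unitaryGroupOfForm (conjLocal L (IsCMField.complexConj L) v) (cmLocalForm L 3 v))))) *
            α ((torusChart L v m : ↥(cmBorelTriple L 3 v).M) : ↥(unitaryGroupOfForm (conjLocal L (IsCMField.complexConj L) v) (cmLocalForm L 3 v)))))) ∂μM := by
        rw [← integral_smul, ← integral_smul]
    _ = _ := integral_congr_ae (Eventually.of_forall fun m => by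
        simp only [Complex.real_smul, ENNReal.toReal_inv]
        push_cast
        ring)


set_option maxHeartbeats 1600000 in
set_option synthInstance.maxHeartbeats 400000 in
-- instance-term unification at the CM carrier (`quotientMeasure` ∕ canonical family), as in ★ p849989 ∕ ★ (J6-pre)
/-- **INTEGRABILITY OF THE DENSITY-SIDE INTEGRAND** (same data and hypotheses as `integral_mul_eq_integral_classOrbitalIntegral_density_of_measurable`): the function
`m ↦ classOrbitalIntegral mQv φ ⟦ι m⟧ · ((2·((ι_*μM)(compactCore T)).toReal)⁻¹ · D(ι m)) · α(ι m)` is `μM`-INTEGRABLE — the Fubini half of ★ (J0)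
`integral_hypSet_eq_of_tubeJacobian_local` (integrability of `(t, q) ↦ (φ·α)(Φ(q,t))` for `(D · tT|_{T^{reg}}) ⊗ μ₀`), pushed through `Integrable.integral_prod_left`, Mathlib
`integrable_withDensity_iff_integrable_coe_smul`, `T^{reg}` of full measure, `tT = c₀⁻¹ • ι_*μM` and the measurable embedding `ι`.  (Needed by FILE 3 of the road to dominate
the torus-side integrand of van Dijk's formula.) [cite: Rogawski1990, §12.5 p. 182; §12.7 L. 12.7.2 (proof) p. 193] [cite: HarishChandra1970, Lemma 22; Lemma 42]
[cite: DeitmarEchterhoff2014, Thm. 1.5.3] -/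
theorem integrable_classOrbitalIntegral_density_mul_of_measurable
    (hns : ∀ w : PlacesOver L v, IsCMField.complexConj L • w.1 = w.1)
    [MeasurableSpace ↥(unitaryGroupOfForm (conjLocal L (IsCMField.complexConj L) v) (cmLocalForm L 3 v))] [BorelSpace ↥(unitaryGroupOfForm (conjLocal L (IsCMField.complexConj L) v) (cmLocalForm L 3 v))] [LocallyCompactSpace ↥(unitaryGroupOfForm (conjLocal L (IsCMField.complexConj L) v) (cmLocalForm L 3 v))] [SecondCountableTopology ↥(unitaryGroupOfForm (conjLocal L (IsCMField.complexConj L) v) (cmLocalForm L 3 v))] [T2Space ↥(unitaryGroupOfForm (conjLocal L (IsCMField.complexConj L) v) (cmLocalForm L 3 v))]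
    [∀ γ : ↥(unitaryGroupOfForm (conjLocal L (IsCMField.complexConj L) v) (cmLocalForm L 3 v)), MeasurableSpace (↥(unitaryGroupOfForm (conjLocal L (IsCMField.complexConj L) v) (cmLocalForm L 3 v)) ⧸ Subgroup.centralizer ({γ} : Set ↥(unitaryGroupOfForm (conjLocal L (IsCMField.complexConj L) v) (cmLocalForm L 3 v))))] [∀ γ : ↥(unitaryGroupOfForm (conjLocal L (IsCMField.complexConj L) v) (cmLocalForm L 3 v)), BorelSpace (↥(unitaryGroupOfForm (conjLocal L (IsCMField.complexConj L) v) (cmLocalForm L 3 v)) ⧸ Subgroup.centralizer ({γ} : Set ↥(unitaryGroupOfForm (conjLocal L (IsCMField.complexConj L) v) (cmLocalForm L 3 v))))]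
    [MeasurableSpace ((LocalRing L v)ˣ × ↥(normOneUnits (conjLocal L (IsCMField.complexConj L) v)))] [BorelSpace ((LocalRing L v)ˣ × ↥(normOneUnits (conjLocal L (IsCMField.complexConj L) v)))]
    (ν : Measure ↥(unitaryGroupOfForm (conjLocal L (IsCMField.complexConj L) v) (cmLocalForm L 3 v))) [ν.IsHaarMeasure] [ν.IsMulRightInvariant]
    {mQv : OrbitalMeasureFamily ↥(unitaryGroupOfForm (conjLocal L (IsCMField.complexConj L) v) (cmLocalForm L 3 v))} (hcanQ : mQv.IsCanonical (fun γ => IsRegularElt (γ.val : GL (Fin 3) (LocalRing L v))) ν)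
    (μM : Measure ((LocalRing L v)ˣ × ↥(normOneUnits (conjLocal L (IsCMField.complexConj L) v)))) [μM.IsHaarMeasure]
    (w : ↥(unitaryGroupOfForm (conjLocal L (IsCMField.complexConj L) v) (cmLocalForm L 3 v))) (hw : Units.val (w : GL (Fin 3) (LocalRing L v)) = cmLocalForm L 3 v)
    (D : ↥(cmBorelTriple L 3 v).M → ℝ≥0) (hD : Measurable D)
    (hDsq : ∀ t : ↥(cmBorelTriple L 3 v).M, (D t : ℝ) = ((vanDijkWeight L v t).re) ^ 2) :
    ∀ φ α : ↥(unitaryGroupOfForm (conjLocal L (IsCMField.complexConj L) v) (cmLocalForm L 3 v)) → ℂ, Measurable φ → Measurable α →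
      (∀ x : ↥(unitaryGroupOfForm (conjLocal L (IsCMField.complexConj L) v) (cmLocalForm L 3 v)), x ∈ (hyperbolicSet L v : Set ↥(unitaryGroupOfForm (conjLocal L (IsCMField.complexConj L) v) (cmLocalForm L 3 v))) → ∀ h : ↥(unitaryGroupOfForm (conjLocal L (IsCMField.complexConj L) v) (cmLocalForm L 3 v)), α (h * x * h⁻¹) = α x) →
      IntegrableOn (fun x => φ x * α x) (hyperbolicSet L v : Set ↥(unitaryGroupOfForm (conjLocal L (IsCMField.complexConj L) v) (cmLocalForm L 3 v))) ν →
      (∀ x : ↥(unitaryGroupOfForm (conjLocal L (IsCMField.complexConj L) v) (cmLocalForm L 3 v)), x ∉ (hyperbolicSet L v : Set ↥(unitaryGroupOfForm (conjLocal L (IsCMField.complexConj L) v) (cmLocalForm L 3 v))) → φ x = 0) →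
        Integrable (fun m : ((LocalRing L v)ˣ × ↥(normOneUnits (conjLocal L (IsCMField.complexConj L) v))) => classOrbitalIntegral mQv φ (ConjClasses.mk (((torusChart L v m : ↥(cmBorelTriple L 3 v).M) : ↥(unitaryGroupOfForm (conjLocal L (IsCMField.complexConj L) v) (cmLocalForm L 3 v))))) *
            ((((2 * ((μM.map (torusChart L v)) (compactCore ↥(cmBorelTriple L 3 v).M)).toReal)⁻¹ * (D (torusChart L v m) : ℝ) : ℝ) : ℂ) *
              α ((torusChart L v m : ↥(cmBorelTriple L 3 v).M) : ↥(unitaryGroupOfForm (conjLocal L (IsCMField.complexConj L) v) (cmLocalForm L 3 v))))) μM := by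
  intro φ α hφm hαm hαinv hint hφ0
  classical
  letI : MeasurableSpace (↥(unitaryGroupOfForm (conjLocal L (IsCMField.complexConj L) v) (cmLocalForm L 3 v)) ⧸ (cmBorelTriple L 3 v).M) := borel _
  haveI : BorelSpace (↥(unitaryGroupOfForm (conjLocal L (IsCMField.complexConj L) v) (cmLocalForm L 3 v)) ⧸ (cmBorelTriple L 3 v).M) := ⟨rfl⟩
  have hT := isClosed_cmBorelTriple_M L v
  haveI := hT
  have hTc : ∀ a ∈ (cmBorelTriple L 3 v).M, ∀ b ∈ (cmBorelTriple L 3 v).M, a * b = b * a := fun a ha b hb => mul_comm_of_mem_torusU_cmLocal L v ha hb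
  haveI : LocallyCompactSpace ↥(cmBorelTriple L 3 v).M := hT.isClosedEmbedding_subtypeVal.locallyCompactSpace
  haveI : SecondCountableTopology ↥(cmBorelTriple L 3 v).M := TopologicalSpace.Subtype.secondCountableTopology _
  -- §a the Haar measure `tm = ι_* μM` on `T`, the constant `c₀`, THE normalised measure `tT`
  set tm : Measure ↥(cmBorelTriple L 3 v).M := μM.map (torusChart L v) with htm
  haveI : tm.IsHaarMeasure := isHaarMeasure_map_torusChart L v μM
  haveI := F0P3cStCharTSTorusRay.secondCountableTopology_torus L v
  haveI := F0P3cStCharTSTorusRay.locallyCompactSpace_torus L v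
  haveI : μM.Regular := inferInstance
  haveI : μM.IsInvInvariant := inferInstance
  haveI : tm.IsInvInvariant := by
    rw [htm, ← coe_torusChartEquiv]
    exact isInvInvariant_map_mulEquiv (torusChartEquiv L v).toMulEquiv (torusChartEquiv L v).continuous.measurable μM
  obtain ⟨hcoreC, hcoreO⟩ := isCompact_isOpen_compactCore_cmTorus L v
  set c₀ : ℝ≥0∞ := tm (compactCore ↥(cmBorelTriple L 3 v).M) with hc₀
  have hc0 : c₀ ≠ 0 := (hcoreO.measure_pos tm ⟨1, one_mem_compactCore⟩).ne'
  have hctop : c₀ ≠ ∞ := hcoreC.measure_lt_top.ne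
  set tT : Measure ↥(cmBorelTriple L 3 v).M := c₀⁻¹ • tm with htT
  haveI : tT.IsHaarMeasure := Measure.IsHaarMeasure.smul tm (ENNReal.inv_ne_zero.2 hctop) (ENNReal.inv_ne_top.2 hc0)
  haveI : tT.IsInvInvariant := ⟨by rw [Measure.inv_def, htT, Measure.map_smul, ← Measure.inv_def, Measure.inv_eq_self]⟩
  have htT1 : tT (compactCore ↥(cmBorelTriple L 3 v).M) = 1 := by
    rw [htT, Measure.smul_apply, smul_eq_mul, ENNReal.inv_mul_cancel hc0 hctop]
  -- §b the conjugation family; the LOCAL socket at `tT` in ★ p851645's tube shape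
  obtain ⟨Φ, hΦ⟩ := exists_conjFamily (cmBorelTriple L 3 v).M hTc
  have hJ := tubeJacobianSocket_vanDijkWeight_sq L v hns ν w hw D hDsq tT inferInstance inferInstance htT1
  have htube : ∀ (A₀ : Set (↥(unitaryGroupOfForm (conjLocal L (IsCMField.complexConj L) v) (cmLocalForm L 3 v)) ⧸ (cmBorelTriple L 3 v).M)) (V : Set ↥(cmBorelTriple L 3 v).M), Φ '' (A₀ ×ˢ V) =
      {y : ↥(unitaryGroupOfForm (conjLocal L (IsCMField.complexConj L) v) (cmLocalForm L 3 v)) | ∃ (x : ↥(unitaryGroupOfForm (conjLocal L (IsCMField.complexConj L) v) (cmLocalForm L 3 v))) (t : ↥(cmBorelTriple L 3 v).M), (QuotientGroup.mk x : ↥(unitaryGroupOfForm (conjLocal L (IsCMField.complexConj L) v) (cmLocalForm L 3 v)) ⧸ (cmBorelTriple L 3 v).M) ∈ A₀ ∧ t ∈ V ∧ y = x * t * x⁻¹} := by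
    intro A₀ V
    ext y
    constructor
    · rintro ⟨⟨q, t⟩, ⟨hq, ht⟩, rfl⟩
      obtain ⟨x, rfl⟩ := QuotientGroup.mk_surjective q
      exact ⟨x, t, hq, ht, hΦ x t⟩
    · rintro ⟨x, t, hx, ht, rfl⟩
      exact ⟨(QuotientGroup.mk x, t), ⟨hx, ht⟩, hΦ x t⟩
  have hJacLoc' : ∀ t₀ : ↥(cmBorelTriple L 3 v).M, IsRegularElt (((t₀ : ↥(unitaryGroupOfForm (conjLocal L (IsCMField.complexConj L) v) (cmLocalForm L 3 v)))) : GL (Fin 3) (LocalRing L v)) →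
      ∃ U : Set ↥(cmBorelTriple L 3 v).M, IsOpen U ∧ t₀ ∈ U ∧
        ∃ A₀ : Set (↥(unitaryGroupOfForm (conjLocal L (IsCMField.complexConj L) v) (cmLocalForm L 3 v)) ⧸ (cmBorelTriple L 3 v).M), MeasurableSet A₀ ∧ (quotientMeasure (cmBorelTriple L 3 v).M tT (isClosed_cmBorelTriple_M L v) ν) A₀ ≠ 0 ∧ (quotientMeasure (cmBorelTriple L 3 v).M tT (isClosed_cmBorelTriple_M L v) ν) A₀ ≠ ∞ ∧
          ∀ V : Set ↥(cmBorelTriple L 3 v).M, MeasurableSet V → V ⊆ U → (∀ t ∈ V, IsRegularElt (((t : ↥(unitaryGroupOfForm (conjLocal L (IsCMField.complexConj L) v) (cmLocalForm L 3 v)))) : GL (Fin 3) (LocalRing L v))) →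
            (∀ t ∈ V, ∀ t' ∈ V, ((t' : ↥(cmBorelTriple L 3 v).M) : ↥(unitaryGroupOfForm (conjLocal L (IsCMField.complexConj L) v) (cmLocalForm L 3 v))) ≠ w * t * w⁻¹) →
              ν (Φ '' (A₀ ×ˢ V)) = (quotientMeasure (cmBorelTriple L 3 v).M tT (isClosed_cmBorelTriple_M L v) ν) A₀ * ∫⁻ t in V, (D t : ℝ≥0∞) ∂tT := by
    intro t₀ ht₀
    obtain ⟨U, hUo, hU0, A₀, hA₀m, hA₀0, hA₀top, hJ'⟩ := hJ t₀ ht₀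
    exact ⟨U, hUo, hU0, A₀, hA₀m, hA₀0, hA₀top, fun V hVm hVU hVreg hVfree => by rw [htube]; exact hJ' V hVm hVU hVreg hVfree⟩
  -- §c ★ p851645 (Bochner form, LOCAL socket) at `g := φ · α`
  have hΩ := hyperbolicSet_eq_hypSet L v
  rw [hΩ] at hint hφ0
  obtain ⟨hI, -⟩ := integral_hypSet_eq_of_tubeJacobian_local L v hns ν tT Φ hΦ w hw D hD hJacLoc' (fun x => φ x * α x) hint
  -- §d the inner fibre integral at a regular `t` is `α(t) · O^{can}_t(φ)`
  have hinner : ∀ t : ↥(cmBorelTriple L 3 v).M, IsRegularElt (((t : ↥(unitaryGroupOfForm (conjLocal L (IsCMField.complexConj L) v) (cmLocalForm L 3 v)))) : GL (Fin 3) (LocalRing L v)) →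
      ∫ q, φ (Φ (q, t)) * α (Φ (q, t)) ∂(quotientMeasure (cmBorelTriple L 3 v).M tT (isClosed_cmBorelTriple_M L v) ν) =
        classOrbitalIntegral mQv φ (ConjClasses.mk (t : ↥(unitaryGroupOfForm (conjLocal L (IsCMField.complexConj L) v) (cmLocalForm L 3 v)))) * α t := by
    intro t ht
    have htΩ : (t : ↥(unitaryGroupOfForm (conjLocal L (IsCMField.complexConj L) v) (cmLocalForm L 3 v))) ∈ {x | ∃ g t : ↥(unitaryGroupOfForm (conjLocal L (IsCMField.complexConj L) v) (cmLocalForm L 3 v)), t ∈ (cmBorelTriple L 3 v).M ∧ IsRegularElt (t : GL (Fin 3) (LocalRing L v)) ∧ g * t * g⁻¹ = x} := mem_hypSet_of_mem_torusU (conjLocal L (IsCMField.complexConj L) v) (cmLocalForm L 3 v) t.2 ht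
    rw [← hΩ] at htΩ
    have hpt : ∀ q, φ (Φ (q, t)) * α (Φ (q, t)) = φ (Φ (q, t)) * α t := by
      intro q
      induction q using QuotientGroup.induction_on with
      | H x => rw [hΦ, hαinv _ htΩ x]
    rw [integral_congr_ae (Eventually.of_forall hpt), integral_mul_const,
      classOrbitalIntegral_mk_eq_integral_conjFamily L v ν hcanQ tT htT1 Φ hΦ t ht φ hφm]
  -- §e integrability: Fubini in `t`, the density as a scalar, `T^{reg}` of full `tT`-measure, `tT = c₀⁻¹ • ι_*μM`, pull back along `ι`
  have hSm := (isOpen_setOf_isRegularElt_torusU (conjLocal L (IsCMField.complexConj L) v) (cmLocalForm L 3 v)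
    (isUnit_of_ne_zero_of_nonsplit L v hns) (R := LocalRing L v)).measurableSet
  haveI : SigmaFinite (quotientMeasure (cmBorelTriple L 3 v).M tT (isClosed_cmBorelTriple_M L v) ν) := by
    haveI : SecondCountableTopology (↥(unitaryGroupOfForm (conjLocal L (IsCMField.complexConj L) v) (cmLocalForm L 3 v)) ⧸ (cmBorelTriple L 3 v).M) := (QuotientGroup.isQuotientMap_mk _).secondCountableTopology QuotientGroup.isOpenMap_coe
    haveI : LocallyCompactSpace (↥(unitaryGroupOfForm (conjLocal L (IsCMField.complexConj L) v) (cmLocalForm L 3 v)) ⧸ (cmBorelTriple L 3 v).M) := QuotientGroup.instLocallyCompactSpace _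
    haveI : SigmaCompactSpace (↥(unitaryGroupOfForm (conjLocal L (IsCMField.complexConj L) v) (cmLocalForm L 3 v)) ⧸ (cmBorelTriple L 3 v).M) := sigmaCompactSpace_of_locallyCompact_secondCountable
    exact SigmaFinite.of_isFiniteMeasureOnCompacts _
  have h1 : Integrable (fun t : ↥(cmBorelTriple L 3 v).M => ∫ q, φ (Φ (q, t)) * α (Φ (q, t)) ∂(quotientMeasure (cmBorelTriple L 3 v).M tT (isClosed_cmBorelTriple_M L v) ν))
      ((tT.restrict {t : ↥(cmBorelTriple L 3 v).M | IsRegularElt (((t : ↥(unitaryGroupOfForm (conjLocal L (IsCMField.complexConj L) v) (cmLocalForm L 3 v)))) : GL (Fin 3) (LocalRing L v))}).withDensity fun t => (D t : ℝ≥0∞)) :=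
    hI.integral_prod_left
  rw [integrable_withDensity_iff_integrable_coe_smul hD] at h1
  have h2 : Integrable (fun t : ↥(cmBorelTriple L 3 v).M => (D t : ℝ) •
      (classOrbitalIntegral mQv φ (ConjClasses.mk (t : ↥(unitaryGroupOfForm (conjLocal L (IsCMField.complexConj L) v) (cmLocalForm L 3 v)))) * α t))
      (tT.restrict {t : ↥(cmBorelTriple L 3 v).M | IsRegularElt (((t : ↥(unitaryGroupOfForm (conjLocal L (IsCMField.complexConj L) v) (cmLocalForm L 3 v)))) : GL (Fin 3) (LocalRing L v))}) := by
    refine h1.congr ?_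
    filter_upwards [ae_restrict_mem hSm] with t ht
    rw [hinner t ht]
  have hae : ∀ᵐ t : ↥(cmBorelTriple L 3 v).M ∂tT, t ∈ {t : ↥(cmBorelTriple L 3 v).M | IsRegularElt (((t : ↥(unitaryGroupOfForm (conjLocal L (IsCMField.complexConj L) v) (cmLocalForm L 3 v)))) : GL (Fin 3) (LocalRing L v))} :=
    ae_isRegularElt_cmTorus L v tT
  have hme : MeasurableEmbedding (torusChart L v) := by
    rw [← coe_torusChartEquiv]; exact (torusChartEquiv L v).toHomeomorph.measurableEmbedding
  rw [Measure.restrict_eq_self_of_ae_mem hae, htT, integrable_smul_measure (ENNReal.inv_ne_zero.2 hctop) (ENNReal.inv_ne_top.2 hc0), htm,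
    hme.integrable_map_iff] at h2
  have h3 : Integrable (fun m : ((LocalRing L v)ˣ × ↥(normOneUnits (conjLocal L (IsCMField.complexConj L) v))) => (((2 * ((μM.map (torusChart L v)) (compactCore ↥(cmBorelTriple L 3 v).M)).toReal)⁻¹ : ℝ) : ℂ) *
      ((D (torusChart L v m) : ℝ) • (classOrbitalIntegral mQv φ (ConjClasses.mk (((torusChart L v m : ↥(cmBorelTriple L 3 v).M) : ↥(unitaryGroupOfForm (conjLocal L (IsCMField.complexConj L) v) (cmLocalForm L 3 v))))) *
        α ((torusChart L v m : ↥(cmBorelTriple L 3 v).M) : ↥(unitaryGroupOfForm (conjLocal L (IsCMField.complexConj L) v) (cmLocalForm L 3 v)))))) μM :=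
    (h2.const_mul _)
  refine h3.congr (Eventually.of_forall fun m => ?_)
  simp only [Complex.real_smul]
  push_cast
  ring

end CM

end Summit.HodgeConjecture.HodgeConjecture.Cruxes.H413.K2E3WeylHypDensityMeasurable

end
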